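import Literature.Probability.Percolation.TriHexLemma
import Literature.Probability.Percolation.TriHexExclusive
import Literature.Probability.Percolation.TriSubcriticalCrossing
import HarnessLib

/-!
# Translated rectangle crossings of `𝕋`: paths, duality bounds, monotonicity (proofs only)

Topic `Literature/Probability/Percolation`; family `crit-perc`. Probabilistic glue for the
"overlapping parallelograms" arguments of near-critical site percolation on the triangular lattice
(Nolin 2008, §7.4; Kesten 1987; Werner 2009, Lecture 6), in which crossing events of TRANSLATED
parallelograms `[c₀, c₀ + m] × [c₁, c₁ + n]` are combined. No new definitions: the translated
events are the preimages `(SiteConfig.relabel (triShiftIso (-c)).toEquiv)⁻¹' LR(m, n)` /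
`⁻¹' TB(m, n)` of the tree's crossing events `Literature.CritPerc.triLRCrossing m n` (`BoxCrossing.lean`)
and `Literature.StatMech.triTBCrossing m n` (`TriHexLemma.lean`) under the translation automorphism
`triShiftIso` (`TriSubcriticalCrossing.lean`). Contents:

* `SiteConfig.compl_relabel`, `isUpperSet_preimage_relabel`, `determinedBy_preimage_relabel` —
  relabelling commutes with complementation and preserves increasing / local events;
* `pathIn_of_mem_shift_triLRCrossing`, `pathIn_of_mem_shift_triTBCrossing` — a configuration in a
  translated crossing event contains a `𝕋`-path of open sites of the translated parallelogram
  between its two opposite sides, in coordinates (the input format of `TriPathCrossings.lean`,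
  `TriLadder.lean`);
* `shift_triLRCrossing_or_compl`, `shift_triTBCrossing_or_compl` — Hex duality (existence half,
  `triLRCrossing_or_compl_triTBCrossing`) for translated parallelograms, in both orientations;
* `real_shift_triLRCrossing`, `real_shift_triTBCrossing` — translation invariance of the
  probabilities; `one_sub_le_real_shift_triLRCrossing`, `one_sub_le_real_shift_triTBCrossing` —
  the **duality lower bound** `P_p(open hard crossing) ≥ 1 - P_{1-p}(open easy dual crossing)`
  (Bollobás–Riordan 2006, Ch. 5, proof of Lemma 7: colour exchange and reflection);
* `triLRCrossing_mono_height` — widening the parallelogram transversally only helps;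
* `le_real_shift_triLRCrossing_of_half_le`, `le_real_shift_triTBCrossing_of_half_le` —
  monotonicity in `p`: for `p ≥ 1/2` a translated crossing is at least as likely as the
  corresponding crossing at `p = 1/2` (`sitePercolation_real_mono`).

## References

* P. Nolin, *Electron. J. Probab.* 13 (2008), §7.4 [Nolin2008].
* B. Bollobás, O. Riordan, *Percolation*, CUP 2006, Ch. 5, Lemma 7 (proof) [BollobasRiordan2006].

Tree: `SiteConfig.relabel`, `SiteConfig.mem_relabel_iff`, `sitePercolation_real_preimage_relabel`
(`SitePercolationMeasure.lean`), `relabel_mem_siteConnIn_iff` (`SiteConnectionTools.lean`),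
`PathIn.of_mem_siteConnIn` (`SitePaths.lean`), `triShiftIso` (`TriSubcriticalCrossing.lean`),
`triLRCrossing_or_compl_triTBCrossing`, `relabel_transpose_preimage_triLRCrossing`,
`triSitePercolation_real_triTBCrossing`, `sitePercolation_real_preimage_compl` (`TriHexLemma.lean`),
`determinedBy_triLRCrossing`, `measurableSet_triLRCrossing` (`TriHexExclusive.lean`),
`sitePercolation_real_mono` (`SiteMonotonicity.lean`), `DeterminedBy` (`PercolationEvents.lean`).
-/

noncomputable section

open MeasureTheory Set
open scoped unitInterval

namespace Literature.Probability.Percolation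


variable {V W : Type*}

/-! ### Relabelling: complements, increasing events, local events -/

/-- Relabelling commutes with complementation of configurations. [folklore] -/
theorem SiteConfig.compl_relabel (e : V ≃ W) (ω : SiteConfig V) :
    (SiteConfig.relabel e ω)ᶜ = SiteConfig.relabel e ωᶜ := by
  ext w
  simp only [Set.mem_compl_iff, SiteConfig.mem_relabel_iff]

/-- Relabelling is monotone in the configuration. [folklore] -/
theorem SiteConfig.relabel_mono (e : V ≃ W) {ω ω' : SiteConfig V} (h : ω ⊆ ω') :
    SiteConfig.relabel e ω ⊆ SiteConfig.relabel e ω' := fun w hw => by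
  rw [SiteConfig.mem_relabel_iff] at hw ⊢
  exact h hw

/-- The preimage of an increasing event under relabelling is increasing. [folklore] -/
theorem isUpperSet_preimage_relabel (e : V ≃ W) {A : Set (SiteConfig W)} (hA : IsUpperSet A) :
    IsUpperSet (SiteConfig.relabel e ⁻¹' A) := fun _ _ hle hω =>
  hA (SiteConfig.relabel_mono e hle) hω

/-- The preimage under relabelling by `e` of an event determined by the sites of `F` is
determined by the sites of `e.symm '' F`. [folklore] -/
theorem determinedBy_preimage_relabel (e : V ≃ W) {A : Set (SiteConfig W)} {F : Set W}
    (hA : DeterminedBy A F) : DeterminedBy (SiteConfig.relabel e ⁻¹' A) (e.symm '' F) := by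
  rw [determinedBy_iff] at hA ⊢
  intro ω ω' h
  simp only [Set.mem_preimage]
  refine hA _ _ (Set.ext fun w => ?_)
  simp only [Set.mem_inter_iff, SiteConfig.mem_relabel_iff]
  constructor
  · rintro ⟨hw, hwF⟩
    have : e.symm w ∈ ω ∩ e.symm '' F := ⟨hw, Set.mem_image_of_mem _ hwF⟩
    rw [h] at this
    exact ⟨this.1, hwF⟩
  · rintro ⟨hw, hwF⟩
    have : e.symm w ∈ ω' ∩ e.symm '' F := ⟨hw, Set.mem_image_of_mem _ hwF⟩
    rw [← h] at this
    exact ⟨this.1, hwF⟩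

/-! ### Translated crossings as paths in coordinates -/

/-- The translate `R(m, n) + c` of the parallelogram, in coordinates. [folklore] -/
theorem image_triShiftIso_rectangle (c : LatticeModels.Site 2) (m n : ℕ) :
    (triShiftIso (-c) : LatticeModels.Site 2 → LatticeModels.Site 2) ''
        {z : LatticeModels.Site 2 | c 0 ≤ z 0 ∧ z 0 ≤ c 0 + m ∧ c 1 ≤ z 1 ∧ z 1 ≤ c 1 + n} =
      ↑(rectangle m n) := by
  ext z
  simp only [Set.mem_image, Set.mem_setOf_eq, Finset.mem_coe, mem_rectangle_iff]
  constructor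
  · rintro ⟨w, hw, rfl⟩
    simp only [triShiftIso_apply, Pi.add_apply, Pi.neg_apply]
    omega
  · intro hz
    refine ⟨z + c, ?_, ?_⟩
    · simp only [Pi.add_apply]; omega
    · rw [triShiftIso_apply]; abel

/-- **A translated left–right crossing is a path in coordinates.** If `ω - c ∈ LR(m, n)`, i.e.
`ω ∈ (relabel (triShiftIso (-c)))⁻¹' LR(m, n)`, then `ω` contains a `𝕋`-path of open sites of
`[c₀, c₀ + m] × [c₁, c₁ + n]` from its left side `{x₀ = c₀}` to its right side `{x₀ = c₀ + m}`. [folklore] -/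
theorem pathIn_of_mem_shift_triLRCrossing {c : LatticeModels.Site 2} {m n : ℕ} {ω : SiteConfig (LatticeModels.Site 2)}
    (h : ω ∈ SiteConfig.relabel (triShiftIso (-c)).toEquiv ⁻¹' triLRCrossing m n) :
    ∃ u v : LatticeModels.Site 2, u 0 = c 0 ∧ v 0 = c 0 + m ∧
      PathIn LatticeModels.triGraph (ω ∩ {z | c 0 ≤ z 0 ∧ z 0 ≤ c 0 + m ∧ c 1 ≤ z 1 ∧ z 1 ≤ c 1 + n}) u v := by
  obtain ⟨x, hx, y, hy, hxy⟩ := mem_triLRCrossing_iff.1 h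
  have hx' := (Finset.mem_filter.1 hx).2
  have hy' := (Finset.mem_filter.1 hy).2
  have key := (relabel_mem_siteConnIn_iff (triShiftIso (-c)) ω
    {z : LatticeModels.Site 2 | c 0 ≤ z 0 ∧ z 0 ≤ c 0 + m ∧ c 1 ≤ z 1 ∧ z 1 ≤ c 1 + n} (x + c) (y + c)).1
  rw [image_triShiftIso_rectangle] at key
  have hφx : (triShiftIso (-c)) (x + c) = x := by rw [triShiftIso_apply]; abel
  have hφy : (triShiftIso (-c)) (y + c) = y := by rw [triShiftIso_apply]; abel
  rw [hφx, hφy] at key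
  have hP := PathIn.of_mem_siteConnIn (key hxy)
  refine ⟨x + c, y + c, by simp [hx'], by simp [hy']; ring, ?_⟩
  exact hP.mono fun z hz => ⟨hz.2, hz.1⟩

/-- **A translated top–bottom crossing is a path in coordinates**: if
`ω ∈ (relabel (triShiftIso (-c)))⁻¹' TB(m, n)` then `ω` contains a `𝕋`-path of open sites of
`[c₀, c₀ + m] × [c₁, c₁ + n]` from `{x₁ = c₁}` to `{x₁ = c₁ + n}`. [folklore] -/
theorem pathIn_of_mem_shift_triTBCrossing {c : LatticeModels.Site 2} {m n : ℕ} {ω : SiteConfig (LatticeModels.Site 2)}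
    (h : ω ∈ SiteConfig.relabel (triShiftIso (-c)).toEquiv ⁻¹' triTBCrossing m n) :
    ∃ u v : LatticeModels.Site 2, u 1 = c 1 ∧ v 1 = c 1 + n ∧
      PathIn LatticeModels.triGraph (ω ∩ {z | c 0 ≤ z 0 ∧ z 0 ≤ c 0 + m ∧ c 1 ≤ z 1 ∧ z 1 ≤ c 1 + n}) u v := by
  obtain ⟨x, hx, y, hy, hxy⟩ := mem_triTBCrossing_iff.1 h
  have hx' := (Finset.mem_filter.1 hx).2
  have hy' := (Finset.mem_filter.1 hy).2
  have key := (relabel_mem_siteConnIn_iff (triShiftIso (-c)) ω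
    {z : LatticeModels.Site 2 | c 0 ≤ z 0 ∧ z 0 ≤ c 0 + m ∧ c 1 ≤ z 1 ∧ z 1 ≤ c 1 + n} (x + c) (y + c)).1
  rw [image_triShiftIso_rectangle] at key
  have hφx : (triShiftIso (-c)) (x + c) = x := by rw [triShiftIso_apply]; abel
  have hφy : (triShiftIso (-c)) (y + c) = y := by rw [triShiftIso_apply]; abel
  rw [hφx, hφy] at key
  have hP := PathIn.of_mem_siteConnIn (key hxy)
  refine ⟨x + c, y + c, by simp [hx'], by simp [hy']; ring, ?_⟩
  exact hP.mono fun z hz => ⟨hz.2, hz.1⟩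

/-! ### Duality for translated parallelograms -/

/-- The transposition carries `TB(n, m)` to `LR(m, n)` (companion of
`relabel_transpose_preimage_triLRCrossing`). [folklore] -/
theorem relabel_transpose_preimage_triTBCrossing (m n : ℕ) :
    SiteConfig.relabel transposeIso.toEquiv ⁻¹' triTBCrossing n m = triLRCrossing m n := by
  rw [← relabel_transpose_preimage_triLRCrossing n m, ← Set.preimage_comp]
  convert Set.preimage_id
  funext ω
  simp only [Function.comp_apply, id_eq]
  ext w
  rw [SiteConfig.mem_relabel_iff, SiteConfig.mem_relabel_iff]
  change transposeIso.symm (transposeIso.symm w) ∈ ω ↔ w ∈ ω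
  rw [transposeIso_symm_apply, transposeIso_symm_apply, transposeIso_transposeIso]

/-- Hex duality, top–bottom form: every configuration has an open top–bottom crossing of
`R(m, n)` or a closed left–right crossing of it. [cite: BollobasRiordan2006, Ch. 5 Lemma 7] -/
theorem triTBCrossing_or_compl_triLRCrossing (m n : ℕ) (ω : SiteConfig (LatticeModels.Site 2)) :
    ω ∈ triTBCrossing m n ∨ ωᶜ ∈ triLRCrossing m n := by
  rcases triLRCrossing_or_compl_triTBCrossing n m (SiteConfig.relabel transposeIso.toEquiv ω)
    with h | h
  · left
    rwa [← Set.mem_preimage, relabel_transpose_preimage_triLRCrossing] at h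
  · right
    rwa [SiteConfig.compl_relabel, ← Set.mem_preimage,
      relabel_transpose_preimage_triTBCrossing] at h

/-- Hex duality for the translated parallelogram, left–right form: `ω - c ∈ LR(m, n)` or
`ωᶜ - c ∈ TB(m, n)`. [cite: BollobasRiordan2006, Ch. 5 Lemma 7] -/
theorem shift_triLRCrossing_or_compl (c : LatticeModels.Site 2) (m n : ℕ) (ω : SiteConfig (LatticeModels.Site 2)) :
    ω ∈ SiteConfig.relabel (triShiftIso (-c)).toEquiv ⁻¹' triLRCrossing m n ∨
      ωᶜ ∈ SiteConfig.relabel (triShiftIso (-c)).toEquiv ⁻¹' triTBCrossing m n := by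
  rcases triLRCrossing_or_compl_triTBCrossing m n
    (SiteConfig.relabel (triShiftIso (-c)).toEquiv ω) with h | h
  · exact Or.inl h
  · right
    rw [Set.mem_preimage, ← SiteConfig.compl_relabel]
    exact h

/-- Hex duality for the translated parallelogram, top–bottom form: `ω - c ∈ TB(m, n)` or
`ωᶜ - c ∈ LR(m, n)`. [cite: BollobasRiordan2006, Ch. 5 Lemma 7] -/
theorem shift_triTBCrossing_or_compl (c : LatticeModels.Site 2) (m n : ℕ) (ω : SiteConfig (LatticeModels.Site 2)) :
    ω ∈ SiteConfig.relabel (triShiftIso (-c)).toEquiv ⁻¹' triTBCrossing m n ∨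
      ωᶜ ∈ SiteConfig.relabel (triShiftIso (-c)).toEquiv ⁻¹' triLRCrossing m n := by
  rcases triTBCrossing_or_compl_triLRCrossing m n
    (SiteConfig.relabel (triShiftIso (-c)).toEquiv ω) with h | h
  · exact Or.inl h
  · right
    rw [Set.mem_preimage, ← SiteConfig.compl_relabel]
    exact h

/-! ### Probabilities: translation invariance, duality lower bound, monotonicity -/

/-- Translation invariance: `P_p(ω - c ∈ LR(m, n)) = P_p(LR(m, n))`. [folklore] -/
theorem real_shift_triLRCrossing (p : unitInterval) (c : LatticeModels.Site 2) (m n : ℕ) :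
    (LatticeModels.triSitePercolation p).real (SiteConfig.relabel (triShiftIso (-c)).toEquiv ⁻¹' triLRCrossing m n)
      = triLRCrossingProb p m n := by
  rw [LatticeModels.triSitePercolation, sitePercolation_real_preimage_relabel]; rfl

/-- Translation invariance: `P_p(ω - c ∈ TB(m, n)) = P_p(TB(m, n)) = P_p(LR(n, m))`. [folklore] -/
theorem real_shift_triTBCrossing (p : unitInterval) (c : LatticeModels.Site 2) (m n : ℕ) :
    (LatticeModels.triSitePercolation p).real (SiteConfig.relabel (triShiftIso (-c)).toEquiv ⁻¹' triTBCrossing m n)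
      = triLRCrossingProb p n m := by
  rw [LatticeModels.triSitePercolation, sitePercolation_real_preimage_relabel,
    ← triSitePercolation_real_triTBCrossing]; rfl

/-- The translated top–bottom crossing event is measurable. [folklore] -/
theorem measurableSet_shift_triTBCrossing (c : LatticeModels.Site 2) (m n : ℕ) :
    MeasurableSet (SiteConfig.relabel (triShiftIso (-c)).toEquiv ⁻¹' triTBCrossing m n) := by
  refine (SiteConfig.relabel (triShiftIso (-c)).toEquiv).measurable ?_
  rw [← relabel_transpose_preimage_triLRCrossing]
  exact (SiteConfig.relabel transposeIso.toEquiv).measurable (measurableSet_triLRCrossing n m)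

/-- The translated left–right crossing event is measurable. [folklore] -/
theorem measurableSet_shift_triLRCrossing (c : LatticeModels.Site 2) (m n : ℕ) :
    MeasurableSet (SiteConfig.relabel (triShiftIso (-c)).toEquiv ⁻¹' triLRCrossing m n) :=
  (SiteConfig.relabel (triShiftIso (-c)).toEquiv).measurable (measurableSet_triLRCrossing m n)

/-- **Duality lower bound, left–right form**: `P_p(ω - c ∈ LR(m, n)) ≥ 1 - P_{1-p}(LR(n, m))`,
since the complement of the event forces a closed top–bottom crossing of the translated
parallelogram, whose probability is `P_{1-p}(TB(m, n)) = P_{1-p}(LR(n, m))` (colour exchange,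
translation and reflection; Bollobás–Riordan 2006, Ch. 5, proof of Lemma 7). [cite: BollobasRiordan2006, Ch. 5 Lemma 7] -/
theorem one_sub_le_real_shift_triLRCrossing (p : unitInterval) (c : LatticeModels.Site 2) (m n : ℕ) :
    1 - triLRCrossingProb (σ p) n m ≤ (LatticeModels.triSitePercolation p).real
      (SiteConfig.relabel (triShiftIso (-c)).toEquiv ⁻¹' triLRCrossing m n) := by
  set E := SiteConfig.relabel (triShiftIso (-c)).toEquiv ⁻¹' triLRCrossing m n with hE
  set D := compl ⁻¹' (SiteConfig.relabel (triShiftIso (-c)).toEquiv ⁻¹' triTBCrossing m n) with hD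
  have hcover : (Set.univ : Set (SiteConfig (LatticeModels.Site 2))) ⊆ E ∪ D := fun ω _ =>
    shift_triLRCrossing_or_compl c m n ω
  have h1 : (LatticeModels.triSitePercolation p).real Set.univ = 1 := by simp
  have h2 := measureReal_mono hcover (measure_ne_top (LatticeModels.triSitePercolation p) _)
  have h3 := measureReal_union_le (μ := LatticeModels.triSitePercolation p) E D
  have h4 : (LatticeModels.triSitePercolation p).real D = triLRCrossingProb (σ p) n m := by
    rw [hD, LatticeModels.triSitePercolation, sitePercolation_real_preimage_compl, ← LatticeModels.triSitePercolation,
      real_shift_triTBCrossing]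
  rw [h1] at h2
  linarith

/-- **Duality lower bound, top–bottom form**: `P_p(ω - c ∈ TB(m, n)) ≥ 1 - P_{1-p}(LR(m, n))`. [cite: BollobasRiordan2006, Ch. 5 Lemma 7] -/
theorem one_sub_le_real_shift_triTBCrossing (p : unitInterval) (c : LatticeModels.Site 2) (m n : ℕ) :
    1 - triLRCrossingProb (σ p) m n ≤ (LatticeModels.triSitePercolation p).real
      (SiteConfig.relabel (triShiftIso (-c)).toEquiv ⁻¹' triTBCrossing m n) := by
  set E := SiteConfig.relabel (triShiftIso (-c)).toEquiv ⁻¹' triTBCrossing m n with hE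
  set D := compl ⁻¹' (SiteConfig.relabel (triShiftIso (-c)).toEquiv ⁻¹' triLRCrossing m n) with hD
  have hcover : (Set.univ : Set (SiteConfig (LatticeModels.Site 2))) ⊆ E ∪ D := fun ω _ =>
    shift_triTBCrossing_or_compl c m n ω
  have h1 : (LatticeModels.triSitePercolation p).real Set.univ = 1 := by simp
  have h2 := measureReal_mono hcover (measure_ne_top (LatticeModels.triSitePercolation p) _)
  have h3 := measureReal_union_le (μ := LatticeModels.triSitePercolation p) E D
  have h4 : (LatticeModels.triSitePercolation p).real D = triLRCrossingProb (σ p) m n := by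
    rw [hD, LatticeModels.triSitePercolation, sitePercolation_real_preimage_compl, ← LatticeModels.triSitePercolation,
      real_shift_triLRCrossing]
  rw [h1] at h2
  linarith

/-- **Transversal monotonicity**: a left–right crossing of `R(m, n)` is a left–right crossing of
the taller `R(m, n')`, `n ≤ n'`. [folklore] -/
theorem triLRCrossing_mono_height (m : ℕ) {n n' : ℕ} (h : n ≤ n') :
    triLRCrossing m n ⊆ triLRCrossing m n' := by
  intro ω hω
  obtain ⟨x, hx, y, hy, hxy⟩ := mem_triLRCrossing_iff.1 hω
  have hsub : (↑(rectangle m n) : Set (LatticeModels.Site 2)) ⊆ ↑(rectangle m n') := fun z hz => by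
    have := mem_rectangle_iff.1 (Finset.mem_coe.1 hz)
    exact Finset.mem_coe.2 (mem_rectangle_iff.2 (by omega))
  refine mem_triLRCrossing_iff.2 ⟨x, ?_, y, ?_, siteConnIn_mono_set LatticeModels.triGraph hsub x y hxy⟩
  · have h1 := Finset.mem_filter.1 hx
    have h2 := mem_rectangle_iff.1 h1.1
    exact Finset.mem_filter.2 ⟨mem_rectangle_iff.2 (by omega), h1.2⟩
  · have h1 := Finset.mem_filter.1 hy
    have h2 := mem_rectangle_iff.1 h1.1
    exact Finset.mem_filter.2 ⟨mem_rectangle_iff.2 (by omega), h1.2⟩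

/-- `P_p(LR(m, n)) ≤ P_p(LR(m, n'))` for `n ≤ n'`. [folklore] -/
theorem triLRCrossingProb_mono_height (p : unitInterval) (m : ℕ) {n n' : ℕ} (h : n ≤ n') :
    triLRCrossingProb p m n ≤ triLRCrossingProb p m n' :=
  measureReal_mono (triLRCrossing_mono_height m h) (measure_ne_top _ _)

/-- **Monotonicity in `p`, left–right form**: for `1/2 ≤ p`,
`P_{1/2}(LR(m, n)) ≤ P_p(ω - c ∈ LR(m, n))`. [folklore] -/
theorem le_real_shift_triLRCrossing_of_half_le {p : unitInterval} (hp : half ≤ p) (c : LatticeModels.Site 2)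
    (m n : ℕ) :
    triLRCrossingProb half m n ≤ (LatticeModels.triSitePercolation p).real
      (SiteConfig.relabel (triShiftIso (-c)).toEquiv ⁻¹' triLRCrossing m n) := by
  rw [real_shift_triLRCrossing, triLRCrossingProb, triLRCrossingProb, LatticeModels.triSitePercolation,
    LatticeModels.triSitePercolation]
  exact sitePercolation_real_mono (TriHexExclusive.determinedBy_triLRCrossing m n) (isUpperSet_triLRCrossing m n) hp

/-- **Monotonicity in `p`, top–bottom form**: for `1/2 ≤ p`,
`P_{1/2}(LR(n, m)) ≤ P_p(ω - c ∈ TB(m, n))`. [folklore] -/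
theorem le_real_shift_triTBCrossing_of_half_le {p : unitInterval} (hp : half ≤ p) (c : LatticeModels.Site 2)
    (m n : ℕ) :
    triLRCrossingProb half n m ≤ (LatticeModels.triSitePercolation p).real
      (SiteConfig.relabel (triShiftIso (-c)).toEquiv ⁻¹' triTBCrossing m n) := by
  rw [real_shift_triTBCrossing, triLRCrossingProb, triLRCrossingProb, LatticeModels.triSitePercolation,
    LatticeModels.triSitePercolation]
  exact sitePercolation_real_mono (TriHexExclusive.determinedBy_triLRCrossing n m) (isUpperSet_triLRCrossing n m) hp

/-- The translated crossing events are increasing. [folklore] -/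
theorem isUpperSet_shift_triLRCrossing (c : LatticeModels.Site 2) (m n : ℕ) :
    IsUpperSet (SiteConfig.relabel (triShiftIso (-c)).toEquiv ⁻¹' triLRCrossing m n) :=
  isUpperSet_preimage_relabel _ (isUpperSet_triLRCrossing m n)

/-- The top–bottom crossing event is increasing. [folklore] -/
theorem isUpperSet_triTBCrossing (m n : ℕ) : IsUpperSet (triTBCrossing m n) := by
  rw [← relabel_transpose_preimage_triLRCrossing]
  exact isUpperSet_preimage_relabel _ (isUpperSet_triLRCrossing n m)

/-- The translated top–bottom crossing events are increasing. [folklore] -/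
theorem isUpperSet_shift_triTBCrossing (c : LatticeModels.Site 2) (m n : ℕ) :
    IsUpperSet (SiteConfig.relabel (triShiftIso (-c)).toEquiv ⁻¹' triTBCrossing m n) :=
  isUpperSet_preimage_relabel _ (isUpperSet_triTBCrossing m n)

/-- The top–bottom crossing event is determined by the sites of the parallelogram. [folklore] -/
theorem determinedBy_triTBCrossing (m n : ℕ) :
    DeterminedBy (triTBCrossing m n) ↑(rectangle m n) := by
  have : triTBCrossing m n =
      ⋃ x ∈ bottomSide m n, ⋃ y ∈ topSide m n, siteConnIn LatticeModels.triGraph ↑(rectangle m n) x y := by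
    ext ω; simp [mem_triTBCrossing_iff]
  rw [this]
  exact DeterminedBy.iUnion fun x => DeterminedBy.iUnion fun _ =>
    DeterminedBy.iUnion fun y => DeterminedBy.iUnion fun _ => determinedBy_siteConnIn LatticeModels.triGraph _ x y

/-- The translated crossing events are local: determined by the sites of the translated
parallelogram `R(m, n) + c`. [folklore] -/
theorem determinedBy_shift_triLRCrossing (c : LatticeModels.Site 2) (m n : ℕ) :
    DeterminedBy (SiteConfig.relabel (triShiftIso (-c)).toEquiv ⁻¹' triLRCrossing m n)
      ↑((rectangle m n).image fun z => z + c) := by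
  have h := determinedBy_preimage_relabel (triShiftIso (-c)).toEquiv (TriHexExclusive.determinedBy_triLRCrossing m n)
  convert h using 1
  ext z
  simp only [Finset.coe_image, Set.mem_image, Finset.mem_coe]
  constructor
  · rintro ⟨w, hw, rfl⟩
    exact ⟨w, hw, by simp [triShiftIso, LatticeModels.Site.shift_symm_apply]⟩
  · rintro ⟨w, hw, hwz⟩
    refine ⟨w, hw, ?_⟩
    rw [← hwz]
    simp [triShiftIso, LatticeModels.Site.shift_symm_apply]

/-- The translated top–bottom crossing events are local. [folklore] -/
theorem determinedBy_shift_triTBCrossing (c : LatticeModels.Site 2) (m n : ℕ) :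
    DeterminedBy (SiteConfig.relabel (triShiftIso (-c)).toEquiv ⁻¹' triTBCrossing m n)
      ↑((rectangle m n).image fun z => z + c) := by
  have h := determinedBy_preimage_relabel (triShiftIso (-c)).toEquiv (determinedBy_triTBCrossing m n)
  convert h using 1
  ext z
  simp only [Finset.coe_image, Set.mem_image, Finset.mem_coe]
  constructor
  · rintro ⟨w, hw, rfl⟩
    exact ⟨w, hw, by simp [triShiftIso, LatticeModels.Site.shift_symm_apply]⟩
  · rintro ⟨w, hw, hwz⟩
    refine ⟨w, hw, ?_⟩
    rw [← hwz]
    simp [triShiftIso, LatticeModels.Site.shift_symm_apply]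

/-! ### Converse bridges: paths realise translated crossings -/

/-- **A path in coordinates realises the translated left–right crossing**: if `ω` contains a
`𝕋`-path of open sites of `[c₀, c₀ + m] × [c₁, c₁ + n]` from `{x₀ = c₀}` to `{x₀ = c₀ + m}`, then
`ω - c ∈ LR(m, n)` (converse of `pathIn_of_mem_shift_triLRCrossing`). [folklore] -/
theorem mem_shift_triLRCrossing_of_pathIn {c : LatticeModels.Site 2} {m n : ℕ} {ω : SiteConfig (LatticeModels.Site 2)}
    {u v : LatticeModels.Site 2} (hu : u 0 = c 0) (hv : v 0 = c 0 + m)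
    (h : PathIn LatticeModels.triGraph (ω ∩ {z | c 0 ≤ z 0 ∧ z 0 ≤ c 0 + m ∧ c 1 ≤ z 1 ∧ z 1 ≤ c 1 + n}) u v) :
    ω ∈ SiteConfig.relabel (triShiftIso (-c)).toEquiv ⁻¹' triLRCrossing m n := by
  have hub := h.left_mem.2
  have hvb := h.right_mem.2
  simp only [Set.mem_setOf_eq] at hub hvb
  rw [Set.mem_preimage, mem_triLRCrossing_iff]
  refine ⟨u - c, ?_, v - c, ?_, ?_⟩
  · refine Finset.mem_filter.2 ⟨mem_rectangle_iff.2 ?_, ?_⟩ <;> simp only [Pi.sub_apply] <;> omega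
  · refine Finset.mem_filter.2 ⟨mem_rectangle_iff.2 ?_, ?_⟩ <;> simp only [Pi.sub_apply] <;> omega
  · have key := (relabel_mem_siteConnIn_iff (triShiftIso (-c)) ω
      {z : LatticeModels.Site 2 | c 0 ≤ z 0 ∧ z 0 ≤ c 0 + m ∧ c 1 ≤ z 1 ∧ z 1 ≤ c 1 + n} u v).2
      (PathIn.mem_siteConnIn (h.mono fun z hz => show z ∈ {z : LatticeModels.Site 2 | c 0 ≤ z 0 ∧ z 0 ≤ c 0 + m ∧
        c 1 ≤ z 1 ∧ z 1 ≤ c 1 + n} ∩ ω from ⟨hz.2, hz.1⟩))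
    rw [image_triShiftIso_rectangle] at key
    have hφu : (triShiftIso (-c)) u = u - c := by rw [triShiftIso_apply]; abel
    have hφv : (triShiftIso (-c)) v = v - c := by rw [triShiftIso_apply]; abel
    rwa [hφu, hφv] at key

/-- **A path in coordinates realises the translated top–bottom crossing** (converse of
`pathIn_of_mem_shift_triTBCrossing`). [folklore] -/
theorem mem_shift_triTBCrossing_of_pathIn {c : LatticeModels.Site 2} {m n : ℕ} {ω : SiteConfig (LatticeModels.Site 2)}
    {u v : LatticeModels.Site 2} (hu : u 1 = c 1) (hv : v 1 = c 1 + n)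
    (h : PathIn LatticeModels.triGraph (ω ∩ {z | c 0 ≤ z 0 ∧ z 0 ≤ c 0 + m ∧ c 1 ≤ z 1 ∧ z 1 ≤ c 1 + n}) u v) :
    ω ∈ SiteConfig.relabel (triShiftIso (-c)).toEquiv ⁻¹' triTBCrossing m n := by
  have hub := h.left_mem.2
  have hvb := h.right_mem.2
  simp only [Set.mem_setOf_eq] at hub hvb
  rw [Set.mem_preimage, mem_triTBCrossing_iff]
  refine ⟨u - c, ?_, v - c, ?_, ?_⟩
  · refine Finset.mem_filter.2 ⟨mem_rectangle_iff.2 ?_, ?_⟩ <;> simp only [Pi.sub_apply] <;> omega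
  · refine Finset.mem_filter.2 ⟨mem_rectangle_iff.2 ?_, ?_⟩ <;> simp only [Pi.sub_apply] <;> omega
  · have key := (relabel_mem_siteConnIn_iff (triShiftIso (-c)) ω
      {z : LatticeModels.Site 2 | c 0 ≤ z 0 ∧ z 0 ≤ c 0 + m ∧ c 1 ≤ z 1 ∧ z 1 ≤ c 1 + n} u v).2
      (PathIn.mem_siteConnIn (h.mono fun z hz => show z ∈ {z : LatticeModels.Site 2 | c 0 ≤ z 0 ∧ z 0 ≤ c 0 + m ∧
        c 1 ≤ z 1 ∧ z 1 ≤ c 1 + n} ∩ ω from ⟨hz.2, hz.1⟩))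
    rw [image_triShiftIso_rectangle] at key
    have hφu : (triShiftIso (-c)) u = u - c := by rw [triShiftIso_apply]; abel
    have hφv : (triShiftIso (-c)) v = v - c := by rw [triShiftIso_apply]; abel
    rwa [hφu, hφv] at key

end Literature.Probability.Percolation
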